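import Literature.Topology.FourManifolds.LefschetzBaseRegular
import HarnessLib

/-!
# Stub `stub_unfoldedSphere` of line `folded-curve-branch-locus` for crux
# `ConvexBisection.AcyclicBisectionRigidity` (stmt-SmoothPoincare4-10507) — auxiliary file 1:
# radial calculus of the defining function `rho 0` of the genus-`0` Lefschetz base

The genus-`0` rung of the line needs `Base 0 ≅ D⁴` for the standard Lefschetz base
`Base 0 = {rho 0 ≤ 1/4} ⊂ ℂ² = ℝ⁴`, `rho 0 = ‖w‖² + eta ‖x‖²`, `w = y² − x − 1`
(`Literature/Topology/FourManifolds/LefschetzBaseModel.lean`, `LefschetzBaseRegular.lean`).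
The proof (auxiliary files 1–2 and the stub file) perturbs `rho 0` to a Morse function with a
single critical point of index `0` and the same sublevel set, and applies Milnor's disc theorem
(`IsMorseAdapted.nonempty_diffeomorph_closedBall`).  This file provides the calculus of `rho 0`
along the **Euler field of the polynomial shear** `(x, y) ↦ (w, y)`, `V(x, y) = (y² + x + 1, y)`:

* `hasDerivAt_rho_lineV`: `d/dt|₀ rho 0 (p + tV) = ρ_V := 2‖w‖² + eta'(‖x‖²) · 2 Re(x̄(y² + x + 1))`
  (along the ray `w` is scaled, `Dw · V = w`), and `hasDerivAt_sigma_lineV`: the squared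
  sheared norm `σ = ‖w‖² + ‖y‖²` has `d/dt|₀ σ(p + tV) = 2σ`;
* `rhoV_nonneg`, `rho_eq_zero_of_rhoV_eq_zero`: where `‖w‖ < 2` (e.g. on the base) `ρ_V ≥ 0`,
  with equality only on the flat part `{w = 0, ‖x‖² ≤ 4}` of the central page (`rho 0 = 0`);
* `rho_eq_zero_of_isMCriticalPt`: every critical point of `rho 0` on `ℝ⁴` lies on that flat part
  (from the `x`- and `y`-variations of `LefschetzBaseRegular.lean`);
* `hasDerivAt_deriv_line`: the second derivative of a `C²` function along a line is its second
  Fréchet derivative (used for the Hessian of the perturbation).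

Everything is proved; no named facts, no `sorry`.
-/

noncomputable section

-- the prescribed namespace `Summit.<P>.<Sub>.…` duplicates `SmoothPoincare4` (P = Sub)
set_option linter.dupNamespace false

open scoped Manifold ContDiff Topology ComplexConjugate
open Set Function Metric
open Literature.Topology.FourManifolds Literature.Topology.FourManifolds.LefschetzBase

namespace Summit.SmoothPoincare4.SmoothPoincare4.Theorems.AcyclicBisectionRigidity.FoldedCurveBranchLocus

/-- Local notation: `𝔼 n = ℝⁿ` (model space). -/
local notation "𝔼 " n:arg => EuclideanSpace ℝ (Fin n)

/-- In genus `0`, `w = y² − x − 1`. [folklore] -/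
theorem w_zero_eq (p : 𝔼 4) : w 0 p = cy p ^ 2 - cx p - 1 := by
  simp [w, Phi]

/-- **The Euler field of the shear** `(x, y) ↦ (w, y)`: `V(x, y) = (y² + x + 1, y)`, i.e.
`d/dt|_{t=1}` of `t ↦ shear⁻¹ (t w, t y)`. [folklore] -/
def eulerV (p : 𝔼 4) : 𝔼 4 := LefschetzBase.mk (cy p ^ 2 + cx p + 1) (cy p)

/-- The line through `p` in the direction of the Euler field at `p`. [folklore] -/
def lineV (p : 𝔼 4) (t : ℝ) : 𝔼 4 := p + t • eulerV p

/-- `x`-coordinate along the `V`-line. [folklore] -/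
@[simp] theorem cx_lineV (p : 𝔼 4) (t : ℝ) :
    cx (lineV p t) = cx p + (t : ℂ) * (cy p ^ 2 + cx p + 1) := by
  simp [lineV, eulerV, cx_add, cx_smul]

/-- `y`-coordinate along the `V`-line. [folklore] -/
@[simp] theorem cy_lineV (p : 𝔼 4) (t : ℝ) : cy (lineV p t) = cy p + (t : ℂ) * cy p := by
  simp [lineV, eulerV, cy_add, cy_smul]

/-- The `V`-line starts at `p`. [folklore] -/
@[simp] theorem lineV_zero (p : 𝔼 4) : lineV p 0 = p := by simp [lineV]

/-- `w` along the `V`-line: `w + t w + t² y²`. [folklore] -/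
theorem w_lineV (p : 𝔼 4) (t : ℝ) :
    w 0 (lineV p t) = w 0 p + (t : ℂ) * w 0 p + (t : ℂ) ^ 2 * cy p ^ 2 := by
  simp only [w_zero_eq, cx_lineV, cy_lineV]
  ring

/-- Derivative of `w` along the `V`-line at `t = 0`: `w` itself. [folklore] -/
theorem hasDerivAt_w_lineV (p : 𝔼 4) : HasDerivAt (fun t => w 0 (lineV p t)) (w 0 p) 0 := by
  have h1 := ((hasDerivAt_ofReal' 0).mul_const (w 0 p)).const_add (w 0 p)
  have h2 := ((hasDerivAt_ofReal' 0).pow 2).mul_const (cy p ^ 2)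
  have h := h1.add h2
  have hfun : (fun t => w 0 (lineV p t)) =
      fun t : ℝ => w 0 p + (t : ℂ) * w 0 p + (t : ℂ) ^ 2 * cy p ^ 2 := funext (w_lineV p)
  rw [hfun]
  refine h.congr_deriv ?_
  simp

/-- Derivative of `‖w‖²` along the `V`-line at `t = 0`: `2‖w‖²`. [folklore] -/
theorem hasDerivAt_norm_sq_w_lineV (p : 𝔼 4) :
    HasDerivAt (fun t => ‖w 0 (lineV p t)‖ ^ 2) (2 * ‖w 0 p‖ ^ 2) 0 := by
  have h := hasDerivAt_norm_sq_comp (hasDerivAt_w_lineV p)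
  rw [lineV_zero, re_conj_mul_self] at h
  exact h

/-- Derivative of `‖x‖²` along the `V`-line at `t = 0`. [folklore] -/
theorem hasDerivAt_norm_sq_cx_lineV (p : 𝔼 4) :
    HasDerivAt (fun t => ‖cx (lineV p t)‖ ^ 2)
      (2 * (conj (cx p) * (cy p ^ 2 + cx p + 1)).re) 0 := by
  have h : HasDerivAt (fun t : ℝ => cx p + (t : ℂ) * (cy p ^ 2 + cx p + 1))
      (1 * (cy p ^ 2 + cx p + 1)) 0 :=
    ((hasDerivAt_ofReal' 0).mul_const _).const_add (cx p)
  have h' := hasDerivAt_norm_sq_comp h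
  have hfun : (fun t => ‖cx (lineV p t)‖ ^ 2) =
      fun t : ℝ => ‖cx p + (t : ℂ) * (cy p ^ 2 + cx p + 1)‖ ^ 2 := by
    funext t; rw [cx_lineV]
  rw [hfun]
  refine h'.congr_deriv ?_
  simp

/-- Derivative of `‖y‖²` along the `V`-line at `t = 0`: `2‖y‖²`. [folklore] -/
theorem hasDerivAt_norm_sq_cy_lineV (p : 𝔼 4) :
    HasDerivAt (fun t => ‖cy (lineV p t)‖ ^ 2) (2 * ‖cy p‖ ^ 2) 0 := by
  have h : HasDerivAt (fun t : ℝ => cy p + (t : ℂ) * cy p) (1 * cy p) 0 :=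
    ((hasDerivAt_ofReal' 0).mul_const _).const_add (cy p)
  have h' := hasDerivAt_norm_sq_comp h
  have hfun : (fun t => ‖cy (lineV p t)‖ ^ 2) = fun t : ℝ => ‖cy p + (t : ℂ) * cy p‖ ^ 2 := by
    funext t; rw [cy_lineV]
  rw [hfun]
  refine h'.congr_deriv ?_
  simp only [Complex.ofReal_zero, zero_mul, add_zero, one_mul, re_conj_mul_self]

/-- The derivative of `rho 0` along the Euler field:
`ρ_V = 2‖w‖² + eta'(‖x‖²) · 2 Re(x̄ (y² + x + 1))`. [folklore] -/
def rhoV (p : 𝔼 4) : ℝ :=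
  2 * ‖w 0 p‖ ^ 2 + deriv eta (‖cx p‖ ^ 2) * (2 * (conj (cx p) * (cy p ^ 2 + cx p + 1)).re)

/-- **Radial identity**: `d/dt|₀ rho 0 (p + t V(p)) = ρ_V(p)`. [folklore] -/
theorem hasDerivAt_rho_lineV (p : 𝔼 4) :
    HasDerivAt (fun t => rho 0 (lineV p t)) (rhoV p) 0 := by
  have h1 := hasDerivAt_norm_sq_w_lineV p
  have hin := hasDerivAt_norm_sq_cx_lineV p
  have hout : HasDerivAt eta (deriv eta (‖cx (lineV p 0)‖ ^ 2)) (‖cx (lineV p 0)‖ ^ 2) :=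
    ((contDiff_eta.differentiable (by simp)) _).hasDerivAt
  have h2 := hout.comp 0 hin
  rw [lineV_zero] at h2
  exact h1.add h2

/-- The squared distance from the centre in the sheared coordinates: `σ = ‖w‖² + ‖y‖²`.
[folklore] -/
def sigma (p : 𝔼 4) : ℝ := ‖w 0 p‖ ^ 2 + ‖cy p‖ ^ 2

/-- `σ` is smooth. [folklore] -/
theorem contDiff_sigma : ContDiff ℝ ∞ sigma :=
  (contDiff_norm_sq_complex.comp (contDiff_w 0)).add (contDiff_norm_sq_complex.comp contDiff_cy)

/-- `σ ≥ 0`. [folklore] -/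
theorem sigma_nonneg (p : 𝔼 4) : 0 ≤ sigma p := add_nonneg (sq_nonneg _) (sq_nonneg _)

/-- `σ` is homogeneous of weight `2` for the Euler field: `d/dt|₀ σ(p + t V(p)) = 2σ(p)`.
[folklore] -/
theorem hasDerivAt_sigma_lineV (p : 𝔼 4) :
    HasDerivAt (fun t => sigma (lineV p t)) (2 * sigma p) 0 := by
  have h := (hasDerivAt_norm_sq_w_lineV p).add (hasDerivAt_norm_sq_cy_lineV p)
  refine h.congr_deriv ?_
  simp only [sigma]; ring


/-! ### Sign of the radial derivative -/

/-- `eta' ≥ 0` (the cut-off is monotone). [folklore] -/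
theorem deriv_eta_nonneg (s : ℝ) : 0 ≤ deriv eta s := eta_monotone.deriv_nonneg

/-- `eta' = 0` inside the flat region. [folklore] -/
theorem deriv_eta_eq_zero_of_lt {s : ℝ} (hs : s < 4) : deriv eta s = 0 :=
  (hasDerivAt_eta_of_lt hs).deriv

/-- `y² + x + 1 = w + 2x + 2` in genus `0`. [folklore] -/
theorem cy_sq_add (p : 𝔼 4) : cy p ^ 2 + cx p + 1 = w 0 p + 2 * cx p + 2 := by
  rw [w_zero_eq]; ring

/-- The real part `Re(x̄ (y² + x + 1)) = 2‖x‖² + Re(x̄ w) + 2 Re x` is positive as soon as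
`‖x‖ ≥ 2` and `‖w‖ < 2`. [folklore] -/
theorem re_factor_pos {p : 𝔼 4} (hx : 2 ≤ ‖cx p‖) (hw : ‖w 0 p‖ < 2) :
    0 < (conj (cx p) * (cy p ^ 2 + cx p + 1)).re := by
  rw [cy_sq_add]
  have e : (conj (cx p) * (w 0 p + 2 * cx p + 2)).re =
      2 * ‖cx p‖ ^ 2 + (conj (cx p) * w 0 p).re + 2 * (cx p).re := by
    simp only [Complex.mul_re, Complex.add_re, Complex.add_im, Complex.mul_im, Complex.conj_re,
      Complex.conj_im, Complex.sq_norm, Complex.normSq_apply, Complex.re_ofNat, Complex.im_ofNat]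
    ring
  rw [e]
  have h2 : |(conj (cx p) * w 0 p).re| ≤ ‖cx p‖ * ‖w 0 p‖ := by
    calc |(conj (cx p) * w 0 p).re| ≤ ‖conj (cx p) * w 0 p‖ := Complex.abs_re_le_norm _
      _ = ‖cx p‖ * ‖w 0 p‖ := by rw [norm_mul, Complex.norm_conj]
  have h3 : |(cx p).re| ≤ ‖cx p‖ := Complex.abs_re_le_norm _
  have h4 := neg_abs_le (conj (cx p) * w 0 p).re
  have h5 := neg_abs_le (cx p).re
  nlinarith [norm_nonneg (w 0 p), norm_nonneg (cx p)]

/-- **The radial derivative is non-negative** wherever `‖w‖ < 2` (in particular on the base):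
`ρ_V ≥ 2‖w‖²`. [folklore] -/
theorem two_mul_norm_sq_le_rhoV {p : 𝔼 4} (hw : ‖w 0 p‖ < 2) : 2 * ‖w 0 p‖ ^ 2 ≤ rhoV p := by
  unfold rhoV
  rcases lt_or_ge (‖cx p‖ ^ 2) 4 with hx | hx
  · rw [deriv_eta_eq_zero_of_lt hx]; simp
  · have hx2 : 2 ≤ ‖cx p‖ := by nlinarith [norm_nonneg (cx p)]
    have := re_factor_pos hx2 hw
    nlinarith [deriv_eta_nonneg (‖cx p‖ ^ 2)]

/-- The radial derivative is non-negative wherever `‖w‖ < 2`. [folklore] -/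
theorem rhoV_nonneg {p : 𝔼 4} (hw : ‖w 0 p‖ < 2) : 0 ≤ rhoV p :=
  le_trans (by positivity) (two_mul_norm_sq_le_rhoV hw)

/-- **Equality case**: if `‖w‖ < 2` and `ρ_V = 0` then `w = 0` and `‖x‖² ≤ 4`, so that
`rho 0 = 0` (the flat part of the central page). [folklore] -/
theorem rho_eq_zero_of_rhoV_eq_zero {p : 𝔼 4} (hw : ‖w 0 p‖ < 2) (h : rhoV p = 0) :
    w 0 p = 0 ∧ rho 0 p = 0 := by
  have h1 := two_mul_norm_sq_le_rhoV hw
  have hw0 : w 0 p = 0 := by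
    have : ‖w 0 p‖ ^ 2 = 0 := by nlinarith [sq_nonneg ‖w 0 p‖]
    exact norm_eq_zero.1 (pow_eq_zero_iff two_ne_zero |>.1 this)
  refine ⟨hw0, ?_⟩
  rcases le_or_gt (‖cx p‖ ^ 2) 4 with hx | hx
  · exact rho_eq_zero_of_w_eq_zero 0 hw0 hx
  · exfalso
    have hx2 : 2 ≤ ‖cx p‖ := by nlinarith [norm_nonneg (cx p)]
    have hf := re_factor_pos hx2 hw
    have hd := deriv_eta_pos hx
    unfold rhoV at h
    rw [hw0, norm_zero] at h
    have : 0 < deriv eta (‖cx p‖ ^ 2) * (2 * (conj (cx p) * (cy p ^ 2 + cx p + 1)).re) :=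
      mul_pos hd (by linarith)
    linarith

/-! ### The critical points of `rho 0` lie on the flat part of the central page -/

/-- General `x`-variation of `rho 0`: `d/dt|₀ rho 0 (p + t(u, 0)) =
2 Re(w̄ (−u)) + eta'(‖x‖²) · 2 Re(x̄ u)`. [folklore] -/
theorem hasDerivAt_rho_lineX_gen (p : 𝔼 4) (u : ℂ) :
    HasDerivAt (fun t => rho 0 (lineX p u t))
      (2 * (conj (w 0 p) * (-u)).re + deriv eta (‖cx p‖ ^ 2) * (2 * (conj (cx p) * u).re)) 0 := by
  have hw := hasDerivAt_w_lineX 0 p u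
  have hw' : HasDerivAt (fun t => w 0 (lineX p u t)) (-u) 0 := by
    refine hw.congr_deriv ?_
    simp
  have h1 := hasDerivAt_norm_sq_comp hw'
  rw [lineX_zero] at h1
  have hin := hasDerivAt_norm_sq_cx_lineX p u
  have hout : HasDerivAt eta (deriv eta (‖cx (lineX p u 0)‖ ^ 2)) (‖cx (lineX p u 0)‖ ^ 2) :=
    ((contDiff_eta.differentiable (by simp)) _).hasDerivAt
  have h2 := hout.comp 0 hin
  rw [lineX_zero] at h2
  exact h1.add h2

/-- At a critical point of `rho 0` every line derivative vanishes. [folklore] -/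
theorem hasDerivAt_line_eq_zero_of_isMCriticalPt {p : 𝔼 4} (hc : IsMCriticalPt (𝓡 4) (rho 0) p)
    {v : 𝔼 4} {d : ℝ} (hline : HasDerivAt (fun t : ℝ => rho 0 (p + t • v)) d 0) : d = 0 := by
  by_contra hd
  exact not_isMCriticalPt_of_hasDerivAt_line ((contDiff_rho 0).differentiable (by simp)) hline hd hc

/-- **The critical points of `rho 0` are the points of the flat central page** (`w = 0`,
`‖x‖² ≤ 4`); in particular `rho 0 = 0` there.  From the `y`-variation `w ȳ = 0`; from the
`x`-variation `w = eta'(‖x‖²) x`; the case `y = 0` forces `‖x‖ ≤ 1` and `w = 0`. [folklore] -/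
theorem rho_eq_zero_of_isMCriticalPt {p : 𝔼 4} (hc : IsMCriticalPt (𝓡 4) (rho 0) p) :
    rho 0 p = 0 := by
  set η' : ℝ := deriv eta (‖cx p‖ ^ 2) with hη'
  have hη'0 : 0 ≤ η' := deriv_eta_nonneg _
  -- `x`-variation with `u = -w + η' x`: `w = η' x`
  set u : ℂ := -w 0 p + (η' : ℂ) * cx p with hu
  have hx := hasDerivAt_line_eq_zero_of_isMCriticalPt hc (hasDerivAt_rho_lineX_gen p u)
  have hkey : 2 * (conj (w 0 p) * (-u)).re + η' * (2 * (conj (cx p) * u).re) = 2 * ‖u‖ ^ 2 := by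
    have e : conj (w 0 p) * (-u) + (η' : ℂ) * (conj (cx p) * u) = conj u * u := by
      rw [hu, map_add, map_neg, map_mul, Complex.conj_ofReal]; ring
    have e2 : (conj (w 0 p) * (-u)).re + η' * (conj (cx p) * u).re = ‖u‖ ^ 2 := by
      rw [← re_conj_mul_self u, ← e, Complex.add_re, Complex.re_ofReal_mul]
    linarith
  rw [hkey] at hx
  have hu0 : u = 0 := by
    have : ‖u‖ ^ 2 = 0 := by linarith
    exact norm_eq_zero.1 (pow_eq_zero_iff two_ne_zero |>.1 this)
  have hwx : w 0 p = (η' : ℂ) * cx p := by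
    have := hu0; rw [hu] at this; linear_combination -this
  -- `y`-variation: `‖y‖² ‖w‖² = 0`
  have hy := hasDerivAt_line_eq_zero_of_isMCriticalPt hc (hasDerivAt_rho_lineY 0 p)
  rcases lt_or_ge (‖cx p‖ ^ 2) 4 with hx4 | hx4
  · -- flat region: `η' = 0`, so `w = 0`
    have h0 : η' = 0 := deriv_eta_eq_zero_of_lt hx4
    rw [h0, Complex.ofReal_zero, zero_mul] at hwx
    exact rho_eq_zero_of_w_eq_zero 0 hwx hx4.le
  · have hx2 : 2 ≤ ‖cx p‖ := by nlinarith [norm_nonneg (cx p)]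
    have hxne : cx p ≠ 0 := by
      intro h; rw [h, norm_zero] at hx2; norm_num at hx2
    rcases mul_eq_zero.1 (show ‖cy p‖ ^ 2 * ‖w 0 p‖ ^ 2 = 0 by nlinarith) with hy0 | hw0
    · -- `y = 0`: `w = -x - 1 = η' x` forces `‖x‖ ≤ 1`
      exfalso
      have hy0' : cy p = 0 := norm_eq_zero.1 (pow_eq_zero_iff two_ne_zero |>.1 hy0)
      have hw' : w 0 p = -cx p - 1 := by rw [w_zero_eq, hy0']; ring
      have h1 : (1 + (η' : ℂ)) * cx p = -1 := by
        rw [hw'] at hwx; linear_combination -hwx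
      have h2 : (1 + η') * ‖cx p‖ = 1 := by
        have := congrArg norm h1
        rw [norm_mul, norm_neg, norm_one] at this
        have e : ‖(1 + (η' : ℂ))‖ = 1 + η' := by
          rw [show (1 + (η' : ℂ)) = ((1 + η' : ℝ) : ℂ) by push_cast; ring, Complex.norm_real,
            Real.norm_of_nonneg (by linarith)]
        rwa [e] at this
      nlinarith [norm_nonneg (cx p)]
    · -- `w = 0`: then `η' x = 0` with `x ≠ 0`, so `η' = 0`, so `‖x‖² = 4`
      have hw0' : w 0 p = 0 := norm_eq_zero.1 (pow_eq_zero_iff two_ne_zero |>.1 hw0)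
      rcases hx4.lt_or_eq with hgt | heq
      · exfalso
        have hpos := deriv_eta_pos hgt
        rw [hw0'] at hwx
        have : (η' : ℂ) = 0 := by
          have := mul_eq_zero.1 hwx.symm
          exact this.resolve_right hxne
        have h0 : η' = 0 := by exact_mod_cast this
        exact hpos.ne' h0
      · exact rho_eq_zero_of_w_eq_zero 0 hw0' heq.symm.le




/-! ### Second derivatives along lines -/

/-- The derivative of `f` along the line `s ↦ p + s v` at any time `t`. [folklore] -/
theorem hasDerivAt_line_at {f : 𝔼 4 → ℝ} (hf : Differentiable ℝ f) (p v : 𝔼 4) (t : ℝ) :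
    HasDerivAt (fun s : ℝ => f (p + s • v)) (fderiv ℝ f (p + t • v) v) t := by
  have hl : HasDerivAt (fun s : ℝ => p + s • v) v t := by
    have h := ((hasDerivAt_id t).smul_const v).const_add p
    rwa [one_smul] at h
  exact (hf (p + t • v)).hasFDerivAt.comp_hasDerivAt t hl

/-- The derivative of `f` along a line, as a function of time. [folklore] -/
theorem deriv_line_eq {f : 𝔼 4 → ℝ} (hf : Differentiable ℝ f) (p v : 𝔼 4) :
    deriv (fun s : ℝ => f (p + s • v)) = fun t => fderiv ℝ f (p + t • v) v :=
  funext fun t => (hasDerivAt_line_at hf p v t).deriv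

/-- **The second derivative along a line is the second Fréchet derivative**:
`d/dt|₀ (Df(p + t v) v) = D²f(p)(v, v)` for `f` of class `C²`. [folklore] -/
theorem hasDerivAt_fderiv_line {f : 𝔼 4 → ℝ} (hf : ContDiff ℝ 2 f) (p v : 𝔼 4) :
    HasDerivAt (fun t : ℝ => fderiv ℝ f (p + t • v) v) (fderiv ℝ (fderiv ℝ f) p v v) 0 := by
  have hd : DifferentiableAt ℝ (fderiv ℝ f) p :=
    ((hf.fderiv_right (m := 1) (by norm_num)).differentiable (by norm_num)) p
  have hl : HasDerivAt (fun s : ℝ => p + s • v) v 0 := by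
    have h := ((hasDerivAt_id (0 : ℝ)).smul_const v).const_add p
    rwa [one_smul] at h
  have hd' : HasFDerivAt (fderiv ℝ f) (fderiv ℝ (fderiv ℝ f) p) (p + (0 : ℝ) • v) := by
    rw [zero_smul, add_zero]; exact hd.hasFDerivAt
  have h1 : HasDerivAt (fun s : ℝ => fderiv ℝ f (p + s • v)) (fderiv ℝ (fderiv ℝ f) p v) 0 :=
    hd'.comp_hasDerivAt (0 : ℝ) hl
  have h2 := h1.clm_apply (hasDerivAt_const (0 : ℝ) v)
  simpa using h2

/-- Hence `D²f(p)(v, v)` is the derivative at `0` of `deriv (t ↦ f(p + t v))`. [folklore] -/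
theorem hasDerivAt_deriv_line {f : 𝔼 4 → ℝ} (hf : ContDiff ℝ 2 f) (p v : 𝔼 4) :
    HasDerivAt (deriv (fun s : ℝ => f (p + s • v))) (fderiv ℝ (fderiv ℝ f) p v v) 0 := by
  rw [deriv_line_eq (hf.differentiable (by norm_num)) p v]
  exact hasDerivAt_fderiv_line hf p v

/-- **Registered helper `helper_rho_zero_eq_zero_of_isMCriticalPt`** (item stmt-SmoothPoincare4-10507,
stub `stub_unfoldedSphere`, auxiliary file 1): the critical points of the defining function `rho 0`
of the genus-`0` Lefschetz base lie on its zero set `{rho 0 = 0}` (the flat central page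
`{w = 0, ‖x‖² ≤ 4}`) — `rho_eq_zero_of_isMCriticalPt` in registered form. [folklore] -/
theorem helper_rho_zero_eq_zero_of_isMCriticalPt : ∀ p : EuclideanSpace ℝ (Fin 4), Literature.Topology.FourManifolds.IsMCriticalPt (𝓡 4) (Literature.Topology.FourManifolds.LefschetzBase.rho 0) p → Literature.Topology.FourManifolds.LefschetzBase.rho 0 p = 0 :=
  fun _ hc => rho_eq_zero_of_isMCriticalPt hc

end Summit.SmoothPoincare4.SmoothPoincare4.Theorems.AcyclicBisectionRigidity.FoldedCurveBranchLocus

end
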